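import Literature.Analysis.FluidPDE.CollisionalTransfer
import Literature.Analysis.FunctionSpaces.TorusCalculusProofs
import Literature.MathematicalPhysics.KineticTheory.HardSphereEulerProofs
import Summits.AtomisticToContinuum.HydrodynamicLimit.Theses.AnnealedZeroHorizon
import HarnessLib

/-!
# Exact mass continuity in annealed form (`AnnealedZeroHorizon.MassContinuity`,
# stmt-AtomisticToContinuum-9259)

For `N + 1` hard spheres on `𝕋³` evolved by a hard-sphere flow `Φ`, a smooth test function `ψ` and
times `t₁ ≤ t₂`, the pathwise mass defect

`D z = ⟨ρ_N(t₂), ψ⟩ − ⟨ρ_N(t₁), ψ⟩ − ∫_{t₁}^{t₂} Σᵢ ⟨m_N(s), ∂ᵢψ⟩ᵢ ds`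

(empirical density / momentum fields of `Φ_t z`) vanishes identically on the good set of the flow:
the position observable `z ↦ Σ_k ψ(x_k)` has streaming derivative `Σ_k Dψ(x_k) v_k` along free
flight and no collisional transfer (positions do not jump), so the weak balance law
`IsHardSphereTrajectory.sub_eq_integral_add_collisionalTransfer` is the fundamental theorem of
calculus for `s ↦ Σ_k ψ(x_k(s))`. Since the local Gibbs law is absolutely continuous with respect
to the Liouville measure, for which the good set is conull, `D = 0` almost surely; hence `D` is
integrable with integral `0`. No kinetic equation and no property of the profiles is used.

References: Spohn 1991, Part I §3.2 (microscopic conservation laws); Gallagher–Saint-Raymond–Texier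
2013, Prop. 4.1.1 (the flow on the good set); Alexander 1975.
-/

namespace Summit.AtomisticToContinuum.HydrodynamicLimit.Theorems

open MeasureTheory Set Filter Topology
open Literature.Analysis.FluidPDE Literature.Analysis.FunctionSpaces
open Literature.MathematicalPhysics.KineticTheory

noncomputable section

variable {d : Type*} [Fintype d] {n : ℕ}

/-- Translations of the flat torus are continuous. [folklore] -/
private theorem massContinuity_torus_continuous_translate (x : UnitAddTorus d) :
    Continuous ((Torus.geometry d).translate x) :=
  continuous_const.add Torus.continuous_proj

/-- **Streaming derivative of a position observable.** Along free flight on `T^d`,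
`d/ds Σ_k ψ(x_k + s v_k) = Σ_k Dψ(x_k + s v_k) v_k` for `C¹` test functions `ψ`. [folklore] -/
theorem hasDerivAt_sum_apply_fst_freeFlight {ψ : UnitAddTorus d → ℝ} (hψ : Torus.IsContDiff 1 ψ)
    (z : Config n d (UnitAddTorus d)) (t : ℝ) :
    HasDerivAt (fun s : ℝ => ∑ k, ψ (freeFlight (Torus.geometry d) s z k).1)
      (∑ k, Torus.fderiv ψ (freeFlight (Torus.geometry d) t z k).1
        (freeFlight (Torus.geometry d) t z k).2) t := by
  simp only [freeFlight_apply, Torus.geometry_translate]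
  exact HasDerivAt.fun_sum fun k _ => Torus.hasDerivAt_apply_add_proj_smul hψ (z k).1 (z k).2 t

/-- The streaming term `z ↦ Σ_k Dψ(x_k) v_k` of a position observable is continuous on phase space
for `C¹` test functions. [folklore] -/
theorem continuous_sum_fderiv_apply {ψ : UnitAddTorus d → ℝ} (hψ : Torus.IsContDiff 1 ψ) :
    Continuous fun z : Config n d (UnitAddTorus d) => ∑ k, Torus.fderiv ψ (z k).1 (z k).2 := by
  refine continuous_finsetSum _ fun k _ => ?_
  have h1 : Continuous fun z : Config n d (UnitAddTorus d) => Torus.fderiv ψ (z k).1 :=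
    (Torus.continuous_fderiv hψ).comp (by fun_prop)
  have h2 : Continuous fun z : Config n d (UnitAddTorus d) => (z k).2 := by fun_prop
  exact h1.clm_apply h2

/-- **Position observables have no collisional transfer.** Along a hard-sphere trajectory on the
torus the jump of `z ↦ Σ_k ψ(x_k)` vanishes at every time (positions are continuous,
`IsHardSphereTrajectory.leftLim_apply_fst`), so its collisional transfer over any window is `0`.
[folklore] -/
theorem collisionalTransfer_sum_apply_fst_eq_zero {ε : ℝ} {γ : ℝ → Config n d (UnitAddTorus d)}
    (hγ : IsHardSphereTrajectory (Torus.geometry d) ε n γ) (ψ : UnitAddTorus d → ℝ) (a b : ℝ) :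
    collisionalTransfer (Torus.geometry d) ε
      (fun z : Config n d (UnitAddTorus d) => ∑ k, ψ (z k).1) γ a b = 0 := by
  have hjump : ∀ t, collisionJump (fun z : Config n d (UnitAddTorus d) => ∑ k, ψ (z k).1) γ t = 0 :=
    fun t => by
      simp only [collisionJump, hγ.leftLim_apply_fst massContinuity_torus_continuous_translate,
        sub_self]
  simp only [collisionalTransfer_def, hjump, finsum_zero]

/-- **Fundamental theorem of calculus for a position observable along a hard-sphere trajectory.**
For a `C¹` test function `ψ` on `T^d` and `a ≤ b`, the streaming term
`s ↦ Σ_k Dψ(x_k(s)) v_k(s)` is integrable on `[a, b]` and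
`Σ_k ψ(x_k(b)) − Σ_k ψ(x_k(a)) = ∫_a^b Σ_k Dψ(x_k(s)) v_k(s) ds` (weak balance law with vanishing
collisional transfer). [folklore] -/
theorem sum_apply_fst_sub_eq_integral {ε : ℝ} {γ : ℝ → Config n d (UnitAddTorus d)}
    (hγ : IsHardSphereTrajectory (Torus.geometry d) ε n γ) {ψ : UnitAddTorus d → ℝ}
    (hψ : Torus.IsContDiff 1 ψ) {a b : ℝ} (hab : a ≤ b) :
    IntervalIntegrable (fun s => ∑ k, Torus.fderiv ψ (γ s k).1 (γ s k).2) volume a b ∧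
      ∑ k, ψ (γ b k).1 - ∑ k, ψ (γ a k).1 =
        ∫ s in a..b, ∑ k, Torus.fderiv ψ (γ s k).1 (γ s k).2 := by
  have H := hγ.sub_eq_integral_add_collisionalTransfer
    (F := fun z : Config n d (UnitAddTorus d) => ∑ k, ψ (z k).1)
    (F' := fun z : Config n d (UnitAddTorus d) => ∑ k, Torus.fderiv ψ (z k).1 (z k).2)
    massContinuity_torus_continuous_translate (hasDerivAt_sum_apply_fst_freeFlight hψ)
    (fun z => (continuous_sum_fderiv_apply hψ).comp
      (continuous_freeFlight_of_continuous_translate massContinuity_torus_continuous_translate z))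
    hab
  rwa [collisionalTransfer_sum_apply_fst_eq_zero hγ ψ a b, add_zero] at H

/-- The tested divergence of the empirical momentum field is the averaged streaming term of the
density observable: `Σᵢ ⟨m_N, ∂ᵢψ⟩ᵢ = N⁻¹ Σ_k Dψ(x_k) v_k`. [folklore] -/
theorem sum_empiricalMomentumField_partialDeriv_apply {N : ℕ} {ψ : T3 → ℝ}
    (hψ : Torus.IsContDiff 1 ψ) (z : Config N (Fin 3) T3) :
    ∑ i, (empiricalMomentumField z (fun y => Torus.partialDeriv i ψ y)) i =
      (N : ℝ)⁻¹ * ∑ k, Torus.fderiv ψ (z k).1 (z k).2 := by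
  simp only [empiricalMomentumField_eq_sum, PiLp.smul_apply, WithLp.ofLp_sum, Finset.sum_apply,
    smul_eq_mul, WithLp.ofLp_smul, Pi.smul_apply, Torus.fderiv_apply_eq_sum_partialDeriv hψ]
  rw [← Finset.mul_sum, Finset.sum_comm]
  refine congrArg _ (Finset.sum_congr rfl fun k _ => Finset.sum_congr rfl fun i _ => ?_)
  ring

/-- **Exact mass continuity, annealed form** (route `AnnealedZeroHorizon`, item
stmt-AtomisticToContinuum-9259): for every `σ > 0`, profiles, flow family `Φ`, `N`, `t₁ ≤ t₂` and
smooth `ψ`, the pathwise defect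
`⟨ρ_N(t₂), ψ⟩ − ⟨ρ_N(t₁), ψ⟩ − ∫_{t₁}^{t₂} Σᵢ ⟨m_N(s), ∂ᵢψ⟩ᵢ ds` is integrable under the local
Gibbs law with integral `0`. It vanishes on the good set of `Φ N`
(`sum_apply_fst_sub_eq_integral` on the orbit), and the local Gibbs law is absolutely continuous
with respect to the Liouville measure, for which the good set is conull. [folklore] -/
theorem massContinuity_proof :
    Summit.AtomisticToContinuum.HydrodynamicLimit.Theses.AnnealedZeroHorizon.MassContinuity := by
  unfold Summit.AtomisticToContinuum.HydrodynamicLimit.Theses.AnnealedZeroHorizon.MassContinuity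
  intro σ _hσ a₀ θ₀ u₀ _ha _hθ _hu _ha0 _hθ0 Φ N t₁ t₂ ht ψ hψ D
  have hψ1 : Torus.IsContDiff 1 ψ := hψ.isContDiff (by simp)
  -- the defect vanishes on the good set
  have hD : ∀ z ∈ (Φ N).good, D z = 0 := by
    intro z hz
    obtain ⟨-, hFTC⟩ := sum_apply_fst_sub_eq_integral ((Φ N).isTrajectory z hz) hψ1 ht
    have hint : (fun s => ∑ i, (empiricalMomentumField ((Φ N).flow s z)
        (fun y => Torus.partialDeriv i ψ y)) i) = fun s => ((N + 1 : ℕ) : ℝ)⁻¹ *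
          ∑ k, Torus.fderiv ψ ((Φ N).flow s z k).1 ((Φ N).flow s z k).2 :=
      funext fun s => sum_empiricalMomentumField_partialDeriv_apply hψ1 _
    simp only [D, hint, intervalIntegral.integral_const_mul, ← hFTC, empiricalDensityField_eq_sum]
    ring
  -- the good set is conull for the (absolutely continuous) local Gibbs law
  have hgood : ∀ᵐ z ∂localGibbsLaw σ a₀ u₀ θ₀ N (Φ N), z ∈ (Φ N).good := by
    rw [localGibbsLaw_eq]
    exact (localGibbsMeasure_absolutelyContinuous σ a₀ u₀ θ₀ N (Φ N)).ae_le (Φ N).ae_mem_good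
  have hae : D =ᵐ[localGibbsLaw σ a₀ u₀ θ₀ N (Φ N)] 0 := by
    filter_upwards [hgood] with z hz using hD z hz
  refine ⟨(integrable_zero _ _ _).congr hae.symm, ?_⟩
  rw [integral_congr_ae hae]
  simp

end

end Summit.AtomisticToContinuum.HydrodynamicLimit.Theorems
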